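/-
  HodgeLocusCensusInclusionRankPointOps.lean — pub-hlocus ENGINE B (ivhs-2, gen 55), PROBE 15b (successor material, R-L572 (b)/(d); probe-only, NOT filed).
  certified instances and evidence bearing on the general Hodge conjecture; no claim.

  KERNEL RANK THEOREMS (evidence class; linear algebra of inclusion matrices; nothing about HC). POINT OPERATORS ON SUBSET SPACES.
  For a point a, Ins_a B B' = [B = insert a B'] ((j+1)-sets × j-sets) and the transpose-shaped Del_a B' B = [B = insert a B']; their action
  (`ins_mulVecLin_apply`: (Ins_a w) B = [a ∈ B] w (B ∖ a); `del_mulVecLin_apply`: (Del_a z) B' = [a ∉ B'] z (B' ∪ a); `incl_mulVecLin_apply`) and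
  three identities with the inclusion matrices W_{k,i} S T = [S ⊆ T] (#S = k, #T = i; W-convention of anchors 204/230/231/271):
  (MI1) W_{k,j+1} Ins_a = [a ∉ B' ∧ C ∖ a ⊆ B'] (`incl_mul_ins`); (MI2) W_{k,j} Del_a = Del_a W_{k+1,j+1} (`incl_mul_del`);
  (MI3) Ins_a Del_a = [B = B₂ ∧ a ∈ B] (`ins_mul_del`). These basis-dependent operators drive the lifting argument of PROBE 15c/15d
  (S_m-equivariant maps M_j → M_i act on S_j by multiples of C(m−2j, i−j) and cannot lift across the primes dividing it).
  7 theorems, 0 defs; imports Mathlib only; no sorries, axioms, instances or notation.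
-/
import Mathlib

set_option linter.dupNamespace false
set_option autoImplicit false

namespace Summit.HodgeConjecture.HodgeConjecture.HodgeLocus.Census.InclusionRankPointOps

open Module

variable (K : Type*) [Field K] {α : Type*} [Fintype α] [DecidableEq α]

/-! ## §1 the point operators `ins_a`, `del_a` and their matrices

`W k i   := Matrix.of fun (S : k-sets) (T : i-sets) => if S ⊆ T then 1 else 0`      (inclusion matrix),
`Ins a j := Matrix.of fun (B : (j+1)-sets) (B' : j-sets) => if B = insert a B' then 1 else 0`,
`Del a j := Matrix.of fun (B' : j-sets) (B : (j+1)-sets) => if B = insert a B' then 1 else 0`. -/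

omit [Fintype α] in
/-- `B = insert a B'` iff `a ∈ B` and `B' = B.erase a` (for `#B = #B' + 1`). -/
theorem eq_insert_iff (a : α) (j : ℕ) (B : {S : Finset α // S.card = j + 1}) (B' : {S : Finset α // S.card = j}) :
    B.1 = insert a B'.1 ↔ a ∈ B.1 ∧ B'.1 = B.1.erase a := by
  constructor
  · intro h
    have ha' : a ∉ B'.1 := by
      intro ha'
      have hc := congrArg Finset.card h
      rw [Finset.insert_eq_of_mem ha', B.2, B'.2] at hc
      omega
    refine ⟨h ▸ Finset.mem_insert_self a B'.1, ?_⟩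
    rw [h, Finset.erase_insert ha']
  · rintro ⟨ha, h'⟩
    rw [h', Finset.insert_erase ha]

/-- the action of the inclusion matrix `W_{k,i}`: `(W_{k,i} x) C = Σ_{T ⊇ C} x T`. -/
theorem incl_mulVecLin_apply (k i : ℕ) (x : {S : Finset α // S.card = i} → K) (C : {S : Finset α // S.card = k}) :
    Matrix.mulVecLin (Matrix.of fun (S : {S : Finset α // S.card = k}) (T : {S : Finset α // S.card = i}) =>
      if S.1 ⊆ T.1 then (1 : K) else 0) x C = ∑ T, if C.1 ⊆ T.1 then x T else 0 := by
  rw [Matrix.mulVecLin_apply, Matrix.mulVec, dotProduct]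
  refine Finset.sum_congr rfl (fun T _ => ?_)
  rw [Matrix.of_apply, boole_mul]

/-- the action of `Ins_a`: `(Ins_a w) B = w (B.erase a)` if `a ∈ B`, else `0`. -/
theorem ins_mulVecLin_apply (a : α) (j : ℕ) (w : {S : Finset α // S.card = j} → K)
    (B : {S : Finset α // S.card = j + 1}) :
    Matrix.mulVecLin (Matrix.of fun (B : {S : Finset α // S.card = j + 1}) (B' : {S : Finset α // S.card = j}) =>
      if B.1 = insert a B'.1 then (1 : K) else 0) w B =
      if h : a ∈ B.1 then w ⟨B.1.erase a, by rw [Finset.card_erase_of_mem h, B.2, Nat.add_sub_cancel]⟩ else 0 := by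
  rw [Matrix.mulVecLin_apply, Matrix.mulVec, dotProduct]
  split_ifs with h
  · rw [Finset.sum_eq_single ⟨B.1.erase a, by rw [Finset.card_erase_of_mem h, B.2, Nat.add_sub_cancel]⟩]
    · rw [Matrix.of_apply, if_pos (Finset.insert_erase h).symm, one_mul]
    · intro B' _ hB'
      rw [Matrix.of_apply, if_neg, zero_mul]
      intro hB
      exact hB' (Subtype.ext ((eq_insert_iff a j B B').mp hB).2)
    · intro hB
      exact absurd (Finset.mem_univ _) hB
  · refine Finset.sum_eq_zero (fun B' _ => ?_)
    rw [Matrix.of_apply, if_neg, zero_mul]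
    intro hB
    exact h ((eq_insert_iff a j B B').mp hB).1

/-- the action of `Del_a`: `(Del_a z) B' = z (insert a B')` if `a ∉ B'`, else `0`. -/
theorem del_mulVecLin_apply (a : α) (j : ℕ) (z : {S : Finset α // S.card = j + 1} → K)
    (B' : {S : Finset α // S.card = j}) :
    Matrix.mulVecLin (Matrix.of fun (B' : {S : Finset α // S.card = j}) (B : {S : Finset α // S.card = j + 1}) =>
      if B.1 = insert a B'.1 then (1 : K) else 0) z B' =
      if h : a ∈ B'.1 then 0 else z ⟨insert a B'.1, by rw [Finset.card_insert_of_notMem h, B'.2]⟩ := by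
  rw [Matrix.mulVecLin_apply, Matrix.mulVec, dotProduct]
  split_ifs with h
  · refine Finset.sum_eq_zero (fun B _ => ?_)
    rw [Matrix.of_apply, if_neg, zero_mul]
    intro hB
    have hc := congrArg Finset.card hB
    rw [Finset.insert_eq_of_mem h, B.2, B'.2] at hc
    omega
  · rw [Finset.sum_eq_single ⟨insert a B'.1, by rw [Finset.card_insert_of_notMem h, B'.2]⟩]
    · rw [Matrix.of_apply, if_pos rfl, one_mul]
    · intro B _ hB
      rw [Matrix.of_apply, if_neg, zero_mul]
      intro hB''
      exact hB (Subtype.ext hB'')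
    · intro hB
      exact absurd (Finset.mem_univ _) hB

/-! ## §2 three matrix identities -/

/-- (MI1) `W_{k,j+1} · Ins_a = [a ∉ B' ∧ C ∖ a ⊆ B']`. -/
theorem incl_mul_ins (a : α) (k j : ℕ) :
    (Matrix.of fun (C : {S : Finset α // S.card = k}) (B : {S : Finset α // S.card = j + 1}) =>
        if C.1 ⊆ B.1 then (1 : K) else 0) *
      (Matrix.of fun (B : {S : Finset α // S.card = j + 1}) (B' : {S : Finset α // S.card = j}) =>
        if B.1 = insert a B'.1 then (1 : K) else 0) =
      Matrix.of fun (C : {S : Finset α // S.card = k}) (B' : {S : Finset α // S.card = j}) =>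
        if a ∉ B'.1 ∧ C.1.erase a ⊆ B'.1 then (1 : K) else 0 := by
  ext C B'
  rw [Matrix.mul_apply, Matrix.of_apply]
  by_cases ha : a ∈ B'.1
  · rw [if_neg (fun h => h.1 ha)]
    refine Finset.sum_eq_zero (fun B _ => ?_)
    rw [Matrix.of_apply, Matrix.of_apply, mul_ite, mul_one, mul_zero, if_neg]
    intro hB
    have hc := congrArg Finset.card hB
    rw [Finset.insert_eq_of_mem ha, B.2, B'.2] at hc
    omega
  · rw [Finset.sum_eq_single ⟨insert a B'.1, by rw [Finset.card_insert_of_notMem ha, B'.2]⟩]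
    · rw [Matrix.of_apply, Matrix.of_apply, if_pos rfl, mul_one]
      simp only [Finset.subset_insert_iff, ha, not_false_eq_true, true_and]
    · intro B _ hB
      rw [Matrix.of_apply, Matrix.of_apply, mul_ite, mul_one, mul_zero, if_neg]
      intro hB''
      exact hB (Subtype.ext hB'')
    · intro hB
      exact absurd (Finset.mem_univ _) hB

/-- (MI2) `W_{k,j} · Del_a^{(j)} = Del_a^{(k)} · W_{k+1,j+1}`. -/
theorem incl_mul_del (a : α) (k j : ℕ) :
    (Matrix.of fun (C : {S : Finset α // S.card = k}) (B' : {S : Finset α // S.card = j}) =>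
        if C.1 ⊆ B'.1 then (1 : K) else 0) *
      (Matrix.of fun (B' : {S : Finset α // S.card = j}) (B : {S : Finset α // S.card = j + 1}) =>
        if B.1 = insert a B'.1 then (1 : K) else 0) =
      (Matrix.of fun (C : {S : Finset α // S.card = k}) (C' : {S : Finset α // S.card = k + 1}) =>
        if C'.1 = insert a C.1 then (1 : K) else 0) *
      (Matrix.of fun (C' : {S : Finset α // S.card = k + 1}) (B : {S : Finset α // S.card = j + 1}) =>
        if C'.1 ⊆ B.1 then (1 : K) else 0) := by
  ext C B
  rw [Matrix.mul_apply, Matrix.mul_apply]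
  -- both sides equal `[a ∈ B ∧ a ∉ C ∧ C ⊆ B]`
  have lhs : (∑ B' : {S : Finset α // S.card = j},
      (Matrix.of (fun (C : {S : Finset α // S.card = k}) (B' : {S : Finset α // S.card = j}) =>
        if C.1 ⊆ B'.1 then (1 : K) else 0) C B') *
      (Matrix.of (fun (B' : {S : Finset α // S.card = j}) (B : {S : Finset α // S.card = j + 1}) =>
        if B.1 = insert a B'.1 then (1 : K) else 0) B' B)) =
      if a ∈ B.1 ∧ a ∉ C.1 ∧ C.1 ⊆ B.1 then 1 else 0 := by
    by_cases ha : a ∈ B.1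
    · rw [Finset.sum_eq_single ⟨B.1.erase a, by rw [Finset.card_erase_of_mem ha, B.2, Nat.add_sub_cancel]⟩]
      · rw [Matrix.of_apply, Matrix.of_apply, if_pos (Finset.insert_erase ha).symm, mul_one]
        simp only [Finset.subset_erase, ha, true_and, and_comm]
      · intro B' _ hB'
        rw [Matrix.of_apply, Matrix.of_apply, mul_ite, mul_one, mul_zero, if_neg]
        intro hB
        exact hB' (Subtype.ext ((eq_insert_iff a j B B').mp hB).2)
      · intro hB
        exact absurd (Finset.mem_univ _) hB
    · rw [if_neg (fun h => ha h.1)]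
      refine Finset.sum_eq_zero (fun B' _ => ?_)
      rw [Matrix.of_apply, Matrix.of_apply, mul_ite, mul_one, mul_zero, if_neg]
      intro hB
      exact ha ((eq_insert_iff a j B B').mp hB).1
  have rhs : (∑ C' : {S : Finset α // S.card = k + 1},
      (Matrix.of (fun (C : {S : Finset α // S.card = k}) (C' : {S : Finset α // S.card = k + 1}) =>
        if C'.1 = insert a C.1 then (1 : K) else 0) C C') *
      (Matrix.of (fun (C' : {S : Finset α // S.card = k + 1}) (B : {S : Finset α // S.card = j + 1}) =>
        if C'.1 ⊆ B.1 then (1 : K) else 0) C' B)) =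
      if a ∈ B.1 ∧ a ∉ C.1 ∧ C.1 ⊆ B.1 then 1 else 0 := by
    by_cases ha : a ∉ C.1
    · rw [Finset.sum_eq_single ⟨insert a C.1, by rw [Finset.card_insert_of_notMem ha, C.2]⟩]
      · rw [Matrix.of_apply, Matrix.of_apply, if_pos rfl, one_mul]
        simp only [Finset.insert_subset_iff, ha, not_false_eq_true, true_and]
      · intro C' _ hC'
        rw [Matrix.of_apply, Matrix.of_apply, ite_mul, one_mul, zero_mul, if_neg]
        intro hC
        exact hC' (Subtype.ext hC)
      · intro hC
        exact absurd (Finset.mem_univ _) hC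
    · rw [if_neg (fun h => ha h.2.1)]
      refine Finset.sum_eq_zero (fun C' _ => ?_)
      rw [Matrix.of_apply, Matrix.of_apply, ite_mul, one_mul, zero_mul, if_neg]
      intro hC
      rw [not_not] at ha
      have hc := congrArg Finset.card hC
      rw [Finset.insert_eq_of_mem ha, C'.2, C.2] at hc
      omega
  rw [lhs, rhs]

/-- (MI3) `Ins_a · Del_a = [B = B₂ ∧ a ∈ B]`. -/
theorem ins_mul_del (a : α) (j : ℕ) :
    (Matrix.of fun (B : {S : Finset α // S.card = j + 1}) (B' : {S : Finset α // S.card = j}) =>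
        if B.1 = insert a B'.1 then (1 : K) else 0) *
      (Matrix.of fun (B' : {S : Finset α // S.card = j}) (B₂ : {S : Finset α // S.card = j + 1}) =>
        if B₂.1 = insert a B'.1 then (1 : K) else 0) =
      Matrix.of fun (B B₂ : {S : Finset α // S.card = j + 1}) => if B = B₂ ∧ a ∈ B.1 then (1 : K) else 0 := by
  ext B B₂
  rw [Matrix.mul_apply, Matrix.of_apply]
  by_cases ha : a ∈ B.1
  · rw [Finset.sum_eq_single ⟨B.1.erase a, by rw [Finset.card_erase_of_mem ha, B.2, Nat.add_sub_cancel]⟩]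
    · rw [Matrix.of_apply, Matrix.of_apply, if_pos (Finset.insert_erase ha).symm, one_mul]
      by_cases hB : B = B₂
      · rw [if_pos (show B = B₂ ∧ a ∈ B.1 from ⟨hB, ha⟩), if_pos]
        rw [Finset.insert_erase ha, hB]
      · rw [if_neg (show ¬(B = B₂ ∧ a ∈ B.1) from fun h => hB h.1), if_neg]
        intro h
        rw [Finset.insert_erase ha] at h
        exact hB (Subtype.ext h.symm)
    · intro B' _ hB'
      rw [Matrix.of_apply, Matrix.of_apply, ite_mul, one_mul, zero_mul, if_neg]
      intro hB
      exact hB' (Subtype.ext ((eq_insert_iff a j B B').mp hB).2)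
    · intro hB
      exact absurd (Finset.mem_univ _) hB
  · rw [if_neg (fun h => ha h.2)]
    refine Finset.sum_eq_zero (fun B' _ => ?_)
    rw [Matrix.of_apply, Matrix.of_apply, ite_mul, one_mul, zero_mul, if_neg]
    intro hB
    exact ha ((eq_insert_iff a j B B').mp hB).1

end Summit.HodgeConjecture.HodgeConjecture.HodgeLocus.Census.InclusionRankPointOps
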